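import Summits.QuantumFields.GaugeBoot.Certificates.SparseReducedTrace
import HarnessLib

/-!
# Sparse certificate replay, part 5: column tables and linear walks (gauge-boot L4 support)

HONEST FRAMING (cell `pub-gaugeboot`): certified bounds on lattice expectations at stated coupling,
gauge group, dimension and torus size; NOT a mass gap, NOT a continuum limit, NOT a string tension;
NOT Yang–Mills-summit-bearing (barriers `FixedCouplingUltralocality`, `PerturbativeInvisibility`).

Sequel of `Certificates/SparseReducedTrace.lean` (emitter `gb_lean_emit` 0.8 "reduced").  MEASURED
on the farm (2026-08-21, 4-block pipeline test of the glyz-c1-4D family: 1079 variables, 204 rows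
with 3114 non-zeros): the residual check of part 2 (`residCheck₂`, which scans every row for
every variable, `O(#vars · nnz)` list steps) costs ≈ 450 s, everything else ≈ 60 s.  This file
replaces the per-variable ROW scans by a per-row-set COLUMN TABLE `CT` (two-level, `getC CT B v =
[(e, A_ev), …]`, emitted once per β next to the rows and re-checked against them ONCE:
`colCheck` / `rowCheck` ⇒ `Σ_e λ_e A_ev = Σ_{(e,c) ∈ CT[v]} λ_e c`, `lamDot₂_eq_lamDotC`), and
replaces every remaining `List.getD v` random access inside a per-variable loop by a LINEAR WALK
over the lists (`residWalk`, `traceWalk`, `finalCheck₃`), each with a soundness lemma that lands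
on the part-2/part-4 predicates (`ResidOK₂`, `TraceOK`, `finalCheck₂`), so that a certificate module
chunks the walks, assembles `ResidOK₂` / `TraceOK` with `.append`, and applies `objective_bound_red`
unchanged.  All `[folklore]`; nothing here is specific to lattice gauge theory.
-/

namespace Summit.QuantumFields.GaugeBoot.Certificates.Sparse

open Matrix Finset Literature.Computation.Certificates

noncomputable section

/-! ## Column tables -/

/-- Two-level column table: `CT[v] = CT2[v / B][v % B] = [(e, A_ev), …]`. [folklore] -/
def getC (CT2 : List (List (List (ℕ × ℚ)))) (B v : ℕ) : List (ℕ × ℚ) :=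
  (CT2.getD (v / B) []).getD (v % B) []

/-- `Σ_{(e, c) ∈ col} λ_e · c`. [folklore] -/
def lamDotC (LM : List ℚ) : List (ℕ × ℚ) → ℚ
  | [] => 0
  | (e, c) :: rest => LM.getD e 0 * c + lamDotC LM rest

/-- `lamDotC` as a mapped list sum. [folklore] -/
theorem lamDotC_eq_sum_map (LM : List ℚ) :
    ∀ col : List (ℕ × ℚ), lamDotC LM col = (col.map fun p => LM.getD p.1 0 * p.2).sum
  | [] => rfl
  | (e, c) :: rest => by simp [lamDotC, lamDotC_eq_sum_map LM rest]

/-- A non-zero first-match lookup is a listed entry. [folklore] -/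
theorem sget_mem {v : ℕ} : ∀ {row : List (ℕ × ℚ)}, sget row v ≠ 0 → (v, sget row v) ∈ row
  | [], h => absurd rfl h
  | (w, c) :: rest, h => by
      by_cases hw : w = v
      · subst hw; simp [sget]
      · have hb : (w == v) = false := beq_eq_false_iff_ne.mpr hw
        have h' : sget rest v ≠ 0 := by simpa [sget, hb] using h
        have hrec := sget_mem h'
        simp only [sget, hb, cond_false]
        exact List.mem_cons_of_mem _ hrec

/-- Boolean membership of a pair `(e, c)` in a column. [folklore] -/
def memPairQ (e : ℕ) (c : ℚ) : List (ℕ × ℚ) → Bool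
  | [] => false
  | p :: ps => (e == p.1 && c == p.2) || memPairQ e c ps

/-- Specification of `memPairQ`. [folklore] -/
theorem memPairQ_iff {e : ℕ} {c : ℚ} : ∀ {l : List (ℕ × ℚ)}, memPairQ e c l = true ↔ (e, c) ∈ l
  | [] => by simp [memPairQ]
  | (p1, p2) :: ps => by simp [memPairQ, memPairQ_iff (l := ps)]

/-- Column check for the variables `lo ≤ v < hi`: the row indices of `CT[v]` increase strictly
(⇒ duplicate-free), are `< ne`, and every listed `(e, c)` has `c = row_e[v]`. [folklore] -/
def colCheck (RW : List (ℚ × List (ℕ × ℚ))) (CT2 : List (List (List (ℕ × ℚ)))) (B ne lo hi : ℕ) :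
    Bool :=
  natAll (hi - lo) fun t =>
    incr ((getC CT2 B (lo + t)).map Prod.fst) &&
      (getC CT2 B (lo + t)).all fun p =>
        decide (p.1 < ne) && (sget (RW.getD p.1 dRow₂).2 (lo + t) == p.2)

/-- What `colCheck` establishes. [folklore] -/
def ColOK (RW : List (ℚ × List (ℕ × ℚ))) (CT2 : List (List (List (ℕ × ℚ)))) (B ne lo hi : ℕ) :
    Prop :=
  ∀ v, lo ≤ v → v < hi → ((getC CT2 B v).map Prod.fst).Nodup ∧
    ∀ p ∈ getC CT2 B v, p.1 < ne ∧ sget (RW.getD p.1 dRow₂).2 v = p.2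

/-- Soundness of `colCheck`. [folklore] -/
theorem colOK_of_check {RW : List (ℚ × List (ℕ × ℚ))} {CT2 : List (List (List (ℕ × ℚ)))}
    {B ne lo hi : ℕ} (h : colCheck RW CT2 B ne lo hi = true) : ColOK RW CT2 B ne lo hi := by
  intro v hlo hhi
  have hv := natAll_iff.mp h (v - lo) (by omega)
  rw [show lo + (v - lo) = v by omega] at hv
  simp only [Bool.and_eq_true, List.all_eq_true, decide_eq_true_eq, beq_iff_eq] at hv
  exact ⟨nodup_of_incr hv.1, fun p hp => hv.2 p hp⟩

/-- Concatenating variable ranges. [folklore] -/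
theorem ColOK.append {RW : List (ℚ × List (ℕ × ℚ))} {CT2 : List (List (List (ℕ × ℚ)))}
    {B ne lo mid hi : ℕ} (h1 : ColOK RW CT2 B ne lo mid) (h2 : ColOK RW CT2 B ne mid hi) :
    ColOK RW CT2 B ne lo hi :=
  fun v hlo hhi => if hm : v < mid then h1 v hlo hm else h2 v (Nat.le_of_not_lt hm) hhi

/-- Row check for the rows `lo ≤ e < hi`: every entry `(v, c)` of row `e` has `(e, c)` listed in
`CT[v]`. [folklore] -/
def rowCheck (RW : List (ℚ × List (ℕ × ℚ))) (CT2 : List (List (List (ℕ × ℚ)))) (B lo hi : ℕ) :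
    Bool :=
  natAll (hi - lo) fun t =>
    (RW.getD (lo + t) dRow₂).2.all fun p => memPairQ (lo + t) p.2 (getC CT2 B p.1)

/-- What `rowCheck` establishes. [folklore] -/
def RowOK (RW : List (ℚ × List (ℕ × ℚ))) (CT2 : List (List (List (ℕ × ℚ)))) (B lo hi : ℕ) :
    Prop :=
  ∀ e, lo ≤ e → e < hi → ∀ p ∈ (RW.getD e dRow₂).2, (e, p.2) ∈ getC CT2 B p.1

/-- Soundness of `rowCheck`. [folklore] -/
theorem rowOK_of_check {RW : List (ℚ × List (ℕ × ℚ))} {CT2 : List (List (List (ℕ × ℚ)))}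
    {B lo hi : ℕ} (h : rowCheck RW CT2 B lo hi = true) : RowOK RW CT2 B lo hi := by
  intro e hlo hhi p hp
  have he := natAll_iff.mp h (e - lo) (by omega)
  rw [show lo + (e - lo) = e by omega] at he
  exact memPairQ_iff.mp (List.all_eq_true.mp he p hp)

/-- Concatenating row ranges. [folklore] -/
theorem RowOK.append {RW : List (ℚ × List (ℕ × ℚ))} {CT2 : List (List (List (ℕ × ℚ)))}
    {B lo mid hi : ℕ} (h1 : RowOK RW CT2 B lo mid) (h2 : RowOK RW CT2 B mid hi) :
    RowOK RW CT2 B lo hi :=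
  fun e hlo hhi => if hm : e < mid then h1 e hlo hm else h2 e (Nat.le_of_not_lt hm) hhi

/-- **Column identity**: `Σ_e λ_e row_e[v] = Σ_{(e,c) ∈ CT[v]} λ_e c`. [folklore] -/
theorem lamDot₂_eq_lamDotC {RW : List (ℚ × List (ℕ × ℚ))} {CT2 : List (List (List (ℕ × ℚ)))}
    {B ne nv : ℕ} {LM : List ℚ} (hLM : LM.length ≤ ne) (hcol : ColOK RW CT2 B ne 0 nv)
    (hrow : RowOK RW CT2 B 0 ne) {v : ℕ} (hv : v < nv) :
    lamDot₂ LM RW v = lamDotC LM (getC CT2 B v) := by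
  classical
  obtain ⟨hnd, hall⟩ := hcol v (Nat.zero_le _) hv
  set col := getC CT2 B v with hcoldef
  rw [lamDot₂_eq_sum v ne LM RW hLM, lamDotC_eq_sum_map]
  -- the list side as a finset sum over the (duplicate-free) pair list
  have hndp : col.Nodup := List.Nodup.of_map _ hnd
  rw [← List.sum_toFinset _ hndp]
  -- re-index the `Fin ne` side by natural numbers
  let emb : Fin ne ↪ ℕ := ⟨Fin.val, Fin.val_injective⟩
  have hfin : ∑ e : Fin ne, LM.getD e.val 0 * sget (RW.getD e.val dRow₂).2 v =
      ∑ n ∈ (Finset.univ : Finset (Fin ne)).map emb, LM.getD n 0 * sget (RW.getD n dRow₂).2 v := by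
    rw [Finset.sum_map]; rfl
  rw [hfin]
  -- the pair list, projected to its keys, injectively
  have hinj : Set.InjOn Prod.fst (col.toFinset : Set (ℕ × ℚ)) := by
    intro p hp q hq hpq
    rw [Finset.mem_coe, List.mem_toFinset] at hp hq
    exact List.inj_on_of_nodup_map hnd hp hq hpq
  have hsum_img : ∑ p ∈ col.toFinset, LM.getD p.1 0 * p.2 =
      ∑ n ∈ col.toFinset.image Prod.fst, LM.getD n 0 * sget (RW.getD n dRow₂).2 v := by
    rw [Finset.sum_image hinj]
    refine Finset.sum_congr rfl fun p hp => ?_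
    rw [List.mem_toFinset] at hp
    rw [(hall p hp).2]
  rw [hsum_img]
  symm
  apply Finset.sum_subset
  · intro n hn
    obtain ⟨p, hp, rfl⟩ := Finset.mem_image.mp hn
    rw [List.mem_toFinset] at hp
    exact Finset.mem_map.mpr ⟨⟨p.1, (hall p hp).1⟩, Finset.mem_univ _, rfl⟩
  · intro n hn hnot
    obtain ⟨e, -, rfl⟩ := Finset.mem_map.mp hn
    by_contra hne
    have hs : sget (RW.getD e.val dRow₂).2 v ≠ 0 := fun h0 => hne (by
      change LM.getD e.val 0 * sget (RW.getD e.val dRow₂).2 v = 0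
      rw [h0, mul_zero])
    have hmem := hrow e.val (Nat.zero_le _) e.isLt _ (sget_mem hs)
    exact hnot (Finset.mem_image.mpr ⟨_, List.mem_toFinset.mpr hmem, rfl⟩)

/-! ## Linear residual walk -/

/-- The residual at `v` computed from the column table. [folklore] -/
def residC (cL : List (ℕ × ℚ)) (LM : List ℚ) (CT2 : List (List (List (ℕ × ℚ)))) (B K : ℕ)
    (t : ℤ) (v : ℕ) : ℚ :=
  sget cL v - lamDotC LM (getC CT2 B v) - (t : ℚ) / ((4 ^ K : ℕ) : ℚ)

/-- Walk `n` steps over the trace table `Ts` and residual table `Rs` from variable `v`, checking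
`residC … t v = r` at each step (`false` if a list runs out). [folklore] -/
def residWalkN (cL : List (ℕ × ℚ)) (LM : List ℚ) (CT2 : List (List (List (ℕ × ℚ)))) (B K : ℕ) :
    ℕ → List ℤ → List ℚ → ℕ → Bool
  | 0, _, _, _ => true
  | _ + 1, [], _, _ => false
  | _ + 1, _ :: _, [], _ => false
  | n + 1, t :: ts, r :: rs, v =>
      (residC cL LM CT2 B K t v == r) && residWalkN cL LM CT2 B K n ts rs (v + 1)

/-- What the walk establishes, relative to the walked lists. [folklore] -/
theorem residWalkN_sound {cL : List (ℕ × ℚ)} {LM : List ℚ} {CT2 : List (List (List (ℕ × ℚ)))}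
    {B K : ℕ} : ∀ {n : ℕ} {Ts : List ℤ} {Rs : List ℚ} {v : ℕ},
    residWalkN cL LM CT2 B K n Ts Rs v = true →
      ∀ u < n, residC cL LM CT2 B K (Ts.getD u 0) (v + u) = Rs.getD u 0
  | 0, _, _, _, _, u, hu => absurd hu (Nat.not_lt_zero _)
  | n + 1, [], _, _, h, _, _ => by simp [residWalkN] at h
  | n + 1, _ :: _, [], _, h, _, _ => by simp [residWalkN] at h
  | n + 1, t :: ts, r :: rs, v, h, u, hu => by
      simp only [residWalkN, Bool.and_eq_true, beq_iff_eq] at h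
      cases u with
      | zero => simpa using h.1
      | succ u =>
          have := residWalkN_sound h.2 u (by omega)
          rw [List.getD_cons_succ, List.getD_cons_succ, show v + (u + 1) = v + 1 + u by omega]
          exact this

/-- Residual walk over the variables `lo ≤ v < hi`. [folklore] -/
def residWalk (cL : List (ℕ × ℚ)) (LM : List ℚ) (CT2 : List (List (List (ℕ × ℚ)))) (B K : ℕ)
    (T : List ℤ) (R : List ℚ) (lo hi : ℕ) : Bool :=
  residWalkN cL LM CT2 B K (hi - lo) (T.drop lo) (R.drop lo) lo

/-- `getD` of a dropped list. [folklore] -/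
theorem getD_drop {α : Type*} (l : List α) (d : α) (i j : ℕ) :
    (l.drop i).getD j d = l.getD (i + j) d := by
  simp [List.getD_eq_getElem?_getD, List.getElem?_drop]

/-- **Soundness of the residual walk**: with sound column/row tables it yields `ResidOK₂`
for the single trace table `[(K, T)]`. [folklore] -/
theorem residOK₂_of_walk {cL : List (ℕ × ℚ)} {LM : List ℚ} {RW : List (ℚ × List (ℕ × ℚ))}
    {CT2 : List (List (List (ℕ × ℚ)))} {B K ne nv lo hi : ℕ} {T : List ℤ} {R : List ℚ}
    (hLM : LM.length ≤ ne) (hcol : ColOK RW CT2 B ne 0 nv) (hrow : RowOK RW CT2 B 0 ne)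
    (hhi : hi ≤ nv) (h : residWalk cL LM CT2 B K T R lo hi = true) :
    ResidOK₂ cL LM RW [(K, T)] R lo hi := by
  intro v hlo hvi
  have hw := residWalkN_sound h (v - lo) (by omega)
  rw [getD_drop, getD_drop, show lo + (v - lo) = v by omega] at hw
  rw [resid₂, lamDot₂_eq_lamDotC hLM hcol hrow (lt_of_lt_of_le hvi hhi), ← hw, residC]
  simp [traceTerm]

/-! ## Linear trace-table walk -/

/-- Walk `n` steps over the trace table from variable `v`, checking `posSumW … (P[v]) = t`.
[folklore] -/
def traceWalkN (GB : List (List (List ℤ))) (EB : List (List (List (List (ℕ × ℤ)))))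
    (P2 : List (List (List (ℕ × ℕ × ℕ)))) (B : ℕ) : ℕ → List ℤ → ℕ → Bool
  | 0, _, _ => true
  | _ + 1, [], _ => false
  | n + 1, t :: ts, v => (posSumW GB EB v (getP P2 B v) == t) && traceWalkN GB EB P2 B n ts (v + 1)

/-- What the trace walk establishes, relative to the walked list. [folklore] -/
theorem traceWalkN_sound {GB : List (List (List ℤ))} {EB : List (List (List (List (ℕ × ℤ))))}
    {P2 : List (List (List (ℕ × ℕ × ℕ)))} {B : ℕ} : ∀ {n : ℕ} {Ts : List ℤ} {v : ℕ},
    traceWalkN GB EB P2 B n Ts v = true → ∀ u < n, posSumW GB EB (v + u) (getP P2 B (v + u)) = Ts.getD u 0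
  | 0, _, _, _, u, hu => absurd hu (Nat.not_lt_zero _)
  | n + 1, [], _, h, _, _ => by simp [traceWalkN] at h
  | n + 1, t :: ts, v, h, u, hu => by
      simp only [traceWalkN, Bool.and_eq_true, beq_iff_eq] at h
      cases u with
      | zero => simpa using h.1
      | succ u =>
          have := traceWalkN_sound h.2 u (by omega)
          rw [List.getD_cons_succ, show v + (u + 1) = v + 1 + u by omega]
          exact this

/-- Trace-table walk over the variables `lo ≤ v < hi`. [folklore] -/
def traceWalk (GB : List (List (List ℤ))) (EB : List (List (List (List (ℕ × ℤ)))))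
    (P2 : List (List (List (ℕ × ℕ × ℕ)))) (B : ℕ) (T : List ℤ) (lo hi : ℕ) : Bool :=
  traceWalkN GB EB P2 B (hi - lo) (T.drop lo) lo

/-- **Soundness of the trace walk.** [folklore] -/
theorem traceOK_of_walk {GB : List (List (List ℤ))} {EB : List (List (List (List (ℕ × ℤ))))}
    {P2 : List (List (List (ℕ × ℕ × ℕ)))} {B lo hi : ℕ} {T : List ℤ}
    (h : traceWalk GB EB P2 B T lo hi = true) : TraceOK GB EB P2 B T lo hi := by
  intro v hlo hvi
  have hw := traceWalkN_sound h (v - lo) (by omega)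
  rwa [getD_drop, show lo + (v - lo) = v by omega] at hw

/-! ## Linear final identity -/

/-- `Σ |x|` over a list (structural). [folklore] -/
def absSumL : List ℚ → ℚ
  | [] => 0
  | x :: xs => |x| + absSumL xs

/-- `absSumL` as a mapped list sum. [folklore] -/
theorem absSumL_eq_sum_map : ∀ l : List ℚ, absSumL l = (l.map fun x => |x|).sum
  | [] => rfl
  | x :: xs => by simp [absSumL, absSumL_eq_sum_map xs]

/-- Linear form of the scalar identity: `R` has exactly `nv` entries and
`R[0] + Σ_e λ_e rhs_e − Σ_{v ≥ 1} |R[v]| = lower`. [folklore] -/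
def finalCheck₃ (LM : List ℚ) (RW : List (ℚ × List (ℕ × ℚ))) (R : List ℚ) (nv : ℕ) (lower : ℚ) :
    Bool :=
  (R.length == nv) && (R.getD 0 0 + lamRhs₂ LM RW - absSumL (R.drop 1) == lower)

/-- `finalCheck₃` implies the part-2 identity `finalCheck₂`. [folklore] -/
theorem finalCheck₂_of_check₃ {LM : List ℚ} {RW : List (ℚ × List (ℕ × ℚ))} {R : List ℚ} {nv : ℕ}
    {lower : ℚ} (h : finalCheck₃ LM RW R nv lower = true) : finalCheck₂ LM RW R nv lower = true := by
  simp only [finalCheck₃, Bool.and_eq_true, beq_iff_eq] at h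
  obtain ⟨hlen, hid⟩ := h
  have habs : absSumL (R.drop 1) = absSum R 1 nv := by
    rw [absSumL_eq_sum_map, absSum,
      sum_map_eq_sum_fin (fun x : ℚ => |x|) 0 (by simp) (nv - 1) (R.drop 1) (by simp [hlen]),
      ← Fin.sum_univ_eq_sum_range]
    exact Finset.sum_congr rfl fun t _ => by rw [getD_drop]
  rw [finalCheck₂, beq_iff_eq, ← habs]
  exact hid

end

end Summit.QuantumFields.GaugeBoot.Certificates.Sparse
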